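import Literature.NumberTheory.Transcendental.DeRhamTheoremMultiplicative
import Summits.HodgeConjecture.HodgeConjecture.Theorems.NikulinTwinTransportAlgebraicClassesOneOneK3CurveKernel

/-!
# Route NikulinTwinTransport · `AlgebraicClassesOneOneK3` (stmt-HodgeConjecture-15041) — closed

Algebraic divisor classes on a projective K3 surface are of Hodge type `(1,1)`: for every
projective K3 surface `S` (the route's unfolded `IsK3Surface S`) and every
`d ∈ algebraicClasses S 1 = N¹H²(S(ℂ); ℂ)`, `IsOfHodgeType 2 S (2*1) 1 1 d` (Voisin I, Prop. 11.20;
Grothendieck 1969, p. 300: the `(n,k,s) = (2,2,1)` slice of "supported classes have Hodge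
coniveau").

The prequels `NikulinTwinTransportAlgebraicClassesOneOneK3` and `…CurveKernel` prove the route
decl for EVERY smooth projective complex surface granted only de Rham's theorem in multiplicative
form, `Literature.NumberTheory.Transcendental.exists_deRhamIsoFamily` (through the bidegree
`(1,1)` of the Gysin morphisms `g_* : H⁰(C(ℂ)) → H²(S(ℂ))` of resolutions `g : C ⟶ S` of the
irreducible curves of `S`, and the curve slice of Deligne's kernel theorem proved there by the
pinch-map argument). That fact is now a theorem of the tree
(`Literature.NumberTheory.Transcendental.exists_deRhamIsoFamily_holds`, file
`Literature/NumberTheory/Transcendental/DeRhamTheoremMultiplicative`: the integration family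
`[α] ↦ [σ ↦ ∫_σ α]` is natural, normalised and multiplicative), so the item closes
unconditionally: `algebraicClassesOneOneK3_proof`.
-/

noncomputable section

-- `Summit.HodgeConjecture.HodgeConjecture.Theorems` is the mandated namespace (single-problem summit:
-- Problem = Summit), which `linter.dupNamespace` flags; the lakefile turns the linter off tree-wide
-- (weak option), restated here so stand-alone elaboration is warning-free too.
set_option linter.dupNamespace false

namespace Summit.HodgeConjecture.HodgeConjecture.Theorems

open scoped Manifold
open Literature.AlgebraicGeometry Literature.AlgebraicGeometry.Motives
open Literature.AlgebraicGeometry.HodgeTheory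
open Literature.NumberTheory.Transcendental (exists_deRhamIsoFamily_holds)

/-- **Algebraic divisor classes on every smooth projective complex surface are of Hodge type
`(1,1)`, unconditionally**: for `S` smooth projective of dimension `2` over `ℂ` and
`d ∈ algebraicClasses S 1 = N¹H²(S(ℂ); ℂ)`, `IsOfHodgeType 2 S (2*1) 1 1 d`. The conditional
`NikulinTwinTransport.isOfHodgeType_oneOne_of_mem_algebraicClasses_of_deRham` fed with the tree's
de Rham theorem `exists_deRhamIsoFamily_holds` (the model spaces `E` are finite-dimensional over
`ℂ`, hence over `ℝ`). [cite: VoisinHodgeI2002, Prop. 11.20 and §7.3.2]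
[cite: Fulton1998, §19.1 Lemma 19.1.1] -/
theorem isOfHodgeType_oneOne_of_mem_algebraicClasses_surface ⦃S : SchemeOver ℂ⦄
    (hS : IsSmoothProjective 2 S) ⦃d : complexBetti S (2 * 1)⦄ (hd : d ∈ algebraicClasses S 1) :
    IsOfHodgeType 2 S (2 * 1) 1 1 d :=
  NikulinTwinTransport.isOfHodgeType_oneOne_of_mem_algebraicClasses_of_deRham
    (fun E _ _ _ ↦ exists_deRhamIsoFamily_holds E) hS hd

/-- **`AlgebraicClassesOneOneK3` holds** (item stmt-HodgeConjecture-15041, the route decl by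
name): for every projective K3 surface `S` and every `d ∈ algebraicClasses S 1`,
`IsOfHodgeType 2 S (2*1) 1 1 d` — the surface theorem
`isOfHodgeType_oneOne_of_mem_algebraicClasses_surface` (equivalently
`NikulinTwinTransport.algebraicClassesOneOneK3_of_deRham` discharged by
`exists_deRhamIsoFamily_holds`); only `IsSmoothProjective 2 S` of the K3 hypotheses is used. [cite: VoisinHodgeI2002, Prop. 11.20] [cite: GrothendieckTopology1969, p. 300] -/
theorem algebraicClassesOneOneK3_proof :
    Summit.HodgeConjecture.HodgeConjecture.Theses.NikulinTwinTransport.AlgebraicClassesOneOneK3 :=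
  fun _ hS _ hd ↦ isOfHodgeType_oneOne_of_mem_algebraicClasses_surface hS.1 hd

end Summit.HodgeConjecture.HodgeConjecture.Theorems

end
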